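import Summits.Ventures.CertifiedManyBodySolver.Observables.TISourcedClusterTrialRowsInterval
import Summits.Ventures.CertifiedManyBodySolver.Observables.TISourcedMinimiserChordFloorExact
import HarnessLib

/-!
# The two-box canonical `hcap` and the minimiser chord floor when BOTH cluster certificates carry an INTERVAL
# number row (two W5-class nodes): the four-corner rule

Cell hubbard-cq (rung CQ, CQ-TABLE §B1-U; lead ACKS 7 2026-08-26T23:58:16Z → obsth-2: «if var-10 ships an `n > 7/8`
partner at `κ = 3/7`, the TWO-W5-node canonical reading without the `4 × 3` cap»). The W5 certificates of
sr-mbsolver-var-10 (FORMAT-mpsgf1; claim nodes `Certificates.cert_sgf_openbox…` written by `gen_cert_lean.py`) report the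
particle number of the open-box MPS as an outward dyadic INTERVAL `nlo·(ab) ≤ Re⟨ψ, Nψ⟩ ≤ nhi·(ab)` (conjunct order
`parity ∧ unit ∧ energy ≤ u·(ab) ∧ nlo·(ab) ≤ N ∧ N ≤ nhi·(ab)`). p6's `TISourcedClusterTrialRowsInterval.lean` (p475630)
handles ONE interval partner mixed with an EXACT-density partner (worst-END rule: p2's mixing side condition
`(n₂ − n)(u₁ + μ₁n₁) + (n − n₁)(u₂ + μ₂n₂) ≤ u(n₂ − n₁)` is affine in each density separately). When BOTH partners are
W5-class nodes — box 1 with density interval `[nlo₁, nhi₁]` below the target density `n`, box 2 with `[nlo₂, nhi₂]` above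
it — the condition is BI-AFFINE in the two unknown exact densities, so it holds on the rectangle iff it holds at its
FOUR CORNERS (`exists_canonicalClass_sourced_le_of_two_clusterNodeIntervals`: fix the exact upper density, apply the
upper worst-end rule at each lower end point, then p6's interval-below theorem). §2 feeds the `hcap` to p2's exact
minimiser chain (`exists_minimiser_canonicalClass`, `re_expect_localPairAt_ge_of_minimiser`): translation-invariant
density-`n` minimisers of `E_h` exist and every one has `(lo − u)/(2h) ≤ Re ω(P₀^d)`
(`minimiser_response_floor_of_two_clusterNodeIntervals`) — the shape in which two var-10 nodes (e.g. `32 × 4` at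
`μ₀ = 7/4` and `μ₀ = 2`, same field) will be consumed BY NAME with four `norm_num` side conditions.

HONEST FRAMING: bookkeeping only — no number, no certificate, no claim node; the eventual leaves are CONDITIONAL
finite-field RESPONSE floors on infinite-volume ground states at fixed density, never order parameters, no phase word,
not a superconductivity verdict. Zero compute; no definition; no named fact; no `sorry`. REUSED (not restated): p6's
`twoCap_mixing_of_endpoints_upper`, `exists_canonicalClass_sourced_le_of_clusterCapInterval_of_clusterCap`; p2's
`exists_minimiser_canonicalClass`, `re_expect_localPairAt_ge_of_minimiser`. References: D. Ruelle, *Statistical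
Mechanics: Rigorous Results* (1969) §3.3–3.4; Bratteli–Robinson I (1987) Thm. 2.3.15; Griffiths, Phys. Rev. 152 (1966)
240 §II.
-/

noncomputable section

namespace Summit.Ventures.CertifiedManyBodySolver.Observables

open Matrix Literature.Probability.LatticeModels
open Literature.MathematicalPhysics.QuantumLattice Literature.MathematicalPhysics.QuantumLattice.ThermodynamicLimit
open Literature.MathematicalPhysics.QuantumLattice.TwoCluster
open scoped ComplexOrder

section TwoIntervals

variable {a₁ b₁ a₂ b₂ : ℕ}

/-- **Two INTERVAL-density cluster nodes bracketing the target density ⇒ the canonical `hcap` (four-corner rule,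
`t′ = 0`).** Box 1 (`a₁ × b₁`, cap `u₁` at `μ₁`, number row in `[nlo₁, nhi₁]·(a₁b₁)`) lies below the target density
(`nhi₁ ≤ n`), box 2 (`a₂ × b₂`, cap `u₂` at `μ₂`, number row in `[nlo₂, nhi₂]·(a₂b₂)`) above it (`n < nlo₂`); if p2's
mixing condition holds at the four corners `(nlo₁|nhi₁) × (nlo₂|nhi₂)`, some translation-invariant state of density
exactly `n` has `μ = 0`-pencil sourced energy `≤ u`. Both nodes in the var-10 conjunct order
`parity ∧ unit ∧ energy ≤ ∧ nlo ≤ N ∧ N ≤ nhi`. [cite: Ruelle1969, §3.4] -/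
theorem exists_canonicalClass_sourced_le_of_two_clusterNodeIntervals (ha₁ : 0 < a₁) (hb₁ : 0 < b₁)
    (ha₂ : 0 < a₂) (hb₂ : 0 < b₂) (U μ₁ μ₂ h : ℝ) {nlo₁ nhi₁ nlo₂ nhi₂ n u₁ u₂ u : ℝ}
    (hC₁ : ∃ ψ : Fock (Orb (Fin a₁ ×ₗ Fin b₁)), HasParity 0 ψ ∧ star ψ ⬝ᵥ ψ = 1 ∧
      (star ψ ⬝ᵥ (dWaveSourceOpenBox a₁ b₁ U μ₁ h *ᵥ ψ)).re ≤ u₁ * ((a₁ : ℝ) * b₁) ∧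
      nlo₁ * ((a₁ : ℝ) * b₁) ≤ (star ψ ⬝ᵥ (totalNumber *ᵥ ψ)).re ∧
      (star ψ ⬝ᵥ (totalNumber *ᵥ ψ)).re ≤ nhi₁ * ((a₁ : ℝ) * b₁))
    (hC₂ : ∃ ψ : Fock (Orb (Fin a₂ ×ₗ Fin b₂)), HasParity 0 ψ ∧ star ψ ⬝ᵥ ψ = 1 ∧
      (star ψ ⬝ᵥ (dWaveSourceOpenBox a₂ b₂ U μ₂ h *ᵥ ψ)).re ≤ u₂ * ((a₂ : ℝ) * b₂) ∧
      nlo₂ * ((a₂ : ℝ) * b₂) ≤ (star ψ ⬝ᵥ (totalNumber *ᵥ ψ)).re ∧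
      (star ψ ⬝ᵥ (totalNumber *ᵥ ψ)).re ≤ nhi₂ * ((a₂ : ℝ) * b₂))
    (hhi : nhi₁ ≤ n) (hlt : n < nlo₂)
    (hll : (nlo₂ - n) * (u₁ + μ₁ * nlo₁) + (n - nlo₁) * (u₂ + μ₂ * nlo₂) ≤ u * (nlo₂ - nlo₁))
    (hlh : (nhi₂ - n) * (u₁ + μ₁ * nlo₁) + (n - nlo₁) * (u₂ + μ₂ * nhi₂) ≤ u * (nhi₂ - nlo₁))
    (hhl : (nlo₂ - n) * (u₁ + μ₁ * nhi₁) + (n - nhi₁) * (u₂ + μ₂ * nlo₂) ≤ u * (nlo₂ - nhi₁))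
    (hhh : (nhi₂ - n) * (u₁ + μ₁ * nhi₁) + (n - nhi₁) * (u₂ + μ₂ * nhi₂) ≤ u * (nhi₂ - nhi₁)) :
    ∃ σ : InfVolFermionState 2, σ.IsTranslationInvariant ∧ σ.density = n ∧
      σ.meanEnergy (hubbardTTPrimeSourcedInteraction 1 0 U 0 dWaveFormFactor h) 1 ≤ u := by
  obtain ⟨ψ₁, hψ₁, h1₁, hE₁, hNlo₁, hNhi₁⟩ := hC₁
  obtain ⟨ψ₂, hψ₂, h1₂, hE₂, hNlo₂, hNhi₂⟩ := hC₂
  have hab : (0 : ℝ) < (a₂ : ℝ) * b₂ := by positivity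
  set n₂ : ℝ := (star ψ₂ ⬝ᵥ (totalNumber *ᵥ ψ₂)).re / ((a₂ : ℝ) * b₂) with hn₂
  have hN₂ : (star ψ₂ ⬝ᵥ (totalNumber *ᵥ ψ₂)).re = n₂ * ((a₂ : ℝ) * b₂) := by rw [hn₂]; field_simp
  have hlo₂ : nlo₂ ≤ n₂ := (le_div_iff₀ hab).2 hNlo₂
  have hhi₂ : n₂ ≤ nhi₂ := (div_le_iff₀ hab).2 hNhi₂
  exact exists_canonicalClass_sourced_le_of_clusterCapInterval_of_clusterCap ha₁ hb₁ ha₂ hb₂ U μ₁ μ₂ h hψ₁ h1₁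
    hψ₂ h1₂ hNlo₁ hNhi₁ hE₁ hN₂ hE₂ hhi (hlt.trans_le hlo₂)
    (twoCap_mixing_of_endpoints_upper hlo₂ hhi₂ hll hlh) (twoCap_mixing_of_endpoints_upper hlo₂ hhi₂ hhl hhh)

variable {ω : InfVolFermionState 2}

/-- **Minimiser floor from two INTERVAL-density nodes (two W5-class certificates bracketing the target density).**
With a certified canonical floor `lo ≤ e(1,0,U,n)` (`U ≥ 0`, `h > 0`, `n ∈ (0,2)`), `nhi₁ ≤ n < nlo₂` and the four
corner conditions, translation-invariant density-`n` minimisers of `E_h` EXIST and EVERY one has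
`(lo − u)/(2h) ≤ Re ω(P₀^d)`. The eventual «W5(32×4, μ₀ = 7/4) ⊕ W5(32×4, μ₀ = 2)» leaf is ONE application with
`norm_num` side conditions. CONDITIONAL on the nodes; a finite-field RESPONSE floor, not an order parameter.
[cite: Griffiths1966, §II] [cite: BratteliRobinsonI1987, Thm. 2.3.15] -/
theorem minimiser_response_floor_of_two_clusterNodeIntervals (ha₁ : 0 < a₁) (hb₁ : 0 < b₁) (ha₂ : 0 < a₂)
    (hb₂ : 0 < b₂) {U μ₁ μ₂ h lo nlo₁ nhi₁ nlo₂ nhi₂ n u₁ u₂ u : ℝ} (hU : 0 ≤ U) (hh : 0 < h) (hn0 : 0 < n)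
    (hn2 : n < 2) (hlo : lo ≤ energyDensityTT' 1 0 U n)
    (hC₁ : ∃ ψ : Fock (Orb (Fin a₁ ×ₗ Fin b₁)), HasParity 0 ψ ∧ star ψ ⬝ᵥ ψ = 1 ∧
      (star ψ ⬝ᵥ (dWaveSourceOpenBox a₁ b₁ U μ₁ h *ᵥ ψ)).re ≤ u₁ * ((a₁ : ℝ) * b₁) ∧
      nlo₁ * ((a₁ : ℝ) * b₁) ≤ (star ψ ⬝ᵥ (totalNumber *ᵥ ψ)).re ∧
      (star ψ ⬝ᵥ (totalNumber *ᵥ ψ)).re ≤ nhi₁ * ((a₁ : ℝ) * b₁))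
    (hC₂ : ∃ ψ : Fock (Orb (Fin a₂ ×ₗ Fin b₂)), HasParity 0 ψ ∧ star ψ ⬝ᵥ ψ = 1 ∧
      (star ψ ⬝ᵥ (dWaveSourceOpenBox a₂ b₂ U μ₂ h *ᵥ ψ)).re ≤ u₂ * ((a₂ : ℝ) * b₂) ∧
      nlo₂ * ((a₂ : ℝ) * b₂) ≤ (star ψ ⬝ᵥ (totalNumber *ᵥ ψ)).re ∧
      (star ψ ⬝ᵥ (totalNumber *ᵥ ψ)).re ≤ nhi₂ * ((a₂ : ℝ) * b₂))
    (hhi : nhi₁ ≤ n) (hlt : n < nlo₂)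
    (hll : (nlo₂ - n) * (u₁ + μ₁ * nlo₁) + (n - nlo₁) * (u₂ + μ₂ * nlo₂) ≤ u * (nlo₂ - nlo₁))
    (hlh : (nhi₂ - n) * (u₁ + μ₁ * nlo₁) + (n - nlo₁) * (u₂ + μ₂ * nhi₂) ≤ u * (nhi₂ - nlo₁))
    (hhl : (nlo₂ - n) * (u₁ + μ₁ * nhi₁) + (n - nhi₁) * (u₂ + μ₂ * nlo₂) ≤ u * (nlo₂ - nhi₁))
    (hhh : (nhi₂ - n) * (u₁ + μ₁ * nhi₁) + (n - nhi₁) * (u₂ + μ₂ * nhi₂) ≤ u * (nhi₂ - nhi₁)) :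
    (∃ ω : InfVolFermionState 2, ω.IsTranslationInvariant ∧ ω.density = n ∧
      ∀ ω' : InfVolFermionState 2, ω'.IsTranslationInvariant → ω'.density = n →
        ω.meanEnergy (hubbardTTPrimeSourcedInteraction 1 0 U 0 dWaveFormFactor h) 1 ≤
          ω'.meanEnergy (hubbardTTPrimeSourcedInteraction 1 0 U 0 dWaveFormFactor h) 1) ∧
    ∀ ω : InfVolFermionState 2, ω.IsTranslationInvariant → ω.density = n →
      (∀ ω' : InfVolFermionState 2, ω'.IsTranslationInvariant → ω'.density = n →
        ω.meanEnergy (hubbardTTPrimeSourcedInteraction 1 0 U 0 dWaveFormFactor h) 1 ≤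
          ω'.meanEnergy (hubbardTTPrimeSourcedInteraction 1 0 U 0 dWaveFormFactor h) 1) →
      (lo - u) / (2 * h) ≤
        (ω.expect (pairRegion (insert 0 unitSteps) 0) (localPairAt (insert 0 unitSteps) dWaveFormFactor 0)).re :=
  ⟨exists_minimiser_canonicalClass _ hn0.le hn2, fun _ hω hρ hmin =>
    re_expect_localPairAt_ge_of_minimiser hω hU hρ hn0 hn2 hh hlo hmin
      (exists_canonicalClass_sourced_le_of_two_clusterNodeIntervals ha₁ hb₁ ha₂ hb₂ U μ₁ μ₂ h hC₁ hC₂ hhi hlt hll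
        hlh hhl hhh)⟩

/-- **The one-interval wrapper with the interval box ABOVE the target density, node shape** (complement of the
«3/14 ⊕ W5» wrapper `minimiser_response_floor_of_clusterNodeInterval_of_clusterNode`, which has the interval box below):
box 1 exact (pin-1 order `parity ∧ unit ∧ N = n₁·(ab) ∧ energy ≤`) below `n`, box 2 a W5-class interval node above `n`;
end-point checks at `n₂ = nlo₂, nhi₂`. Minimisers exist and every one has `(lo − u)/(2h) ≤ Re ω(P₀^d)`.
[cite: Griffiths1966, §II] [cite: BratteliRobinsonI1987, Thm. 2.3.15] -/
theorem minimiser_response_floor_of_clusterNode_of_clusterNodeInterval (ha₁ : 0 < a₁) (hb₁ : 0 < b₁) (ha₂ : 0 < a₂)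
    (hb₂ : 0 < b₂) {U μ₁ μ₂ h lo n₁ nlo₂ nhi₂ n u₁ u₂ u : ℝ} (hU : 0 ≤ U) (hh : 0 < h) (hn0 : 0 < n)
    (hn2 : n < 2) (hlo : lo ≤ energyDensityTT' 1 0 U n)
    (hC₁ : ∃ ψ : Fock (Orb (Fin a₁ ×ₗ Fin b₁)), HasParity 0 ψ ∧ star ψ ⬝ᵥ ψ = 1 ∧
      (star ψ ⬝ᵥ (totalNumber *ᵥ ψ)).re = n₁ * ((a₁ : ℝ) * b₁) ∧
      (star ψ ⬝ᵥ (dWaveSourceOpenBox a₁ b₁ U μ₁ h *ᵥ ψ)).re ≤ u₁ * ((a₁ : ℝ) * b₁))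
    (hC₂ : ∃ ψ : Fock (Orb (Fin a₂ ×ₗ Fin b₂)), HasParity 0 ψ ∧ star ψ ⬝ᵥ ψ = 1 ∧
      (star ψ ⬝ᵥ (dWaveSourceOpenBox a₂ b₂ U μ₂ h *ᵥ ψ)).re ≤ u₂ * ((a₂ : ℝ) * b₂) ∧
      nlo₂ * ((a₂ : ℝ) * b₂) ≤ (star ψ ⬝ᵥ (totalNumber *ᵥ ψ)).re ∧
      (star ψ ⬝ᵥ (totalNumber *ᵥ ψ)).re ≤ nhi₂ * ((a₂ : ℝ) * b₂))
    (hlt : n₁ < n) (hle : n ≤ nlo₂)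
    (hulo : (nlo₂ - n) * (u₁ + μ₁ * n₁) + (n - n₁) * (u₂ + μ₂ * nlo₂) ≤ u * (nlo₂ - n₁))
    (huhi : (nhi₂ - n) * (u₁ + μ₁ * n₁) + (n - n₁) * (u₂ + μ₂ * nhi₂) ≤ u * (nhi₂ - n₁)) :
    (∃ ω : InfVolFermionState 2, ω.IsTranslationInvariant ∧ ω.density = n ∧
      ∀ ω' : InfVolFermionState 2, ω'.IsTranslationInvariant → ω'.density = n →
        ω.meanEnergy (hubbardTTPrimeSourcedInteraction 1 0 U 0 dWaveFormFactor h) 1 ≤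
          ω'.meanEnergy (hubbardTTPrimeSourcedInteraction 1 0 U 0 dWaveFormFactor h) 1) ∧
    ∀ ω : InfVolFermionState 2, ω.IsTranslationInvariant → ω.density = n →
      (∀ ω' : InfVolFermionState 2, ω'.IsTranslationInvariant → ω'.density = n →
        ω.meanEnergy (hubbardTTPrimeSourcedInteraction 1 0 U 0 dWaveFormFactor h) 1 ≤
          ω'.meanEnergy (hubbardTTPrimeSourcedInteraction 1 0 U 0 dWaveFormFactor h) 1) →
      (lo - u) / (2 * h) ≤
        (ω.expect (pairRegion (insert 0 unitSteps) 0) (localPairAt (insert 0 unitSteps) dWaveFormFactor 0)).re := by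
  obtain ⟨ψ₁, hψ₁, h1₁, hN₁, hE₁⟩ := hC₁
  obtain ⟨ψ₂, hψ₂, h1₂, hE₂, hNlo₂, hNhi₂⟩ := hC₂
  exact ⟨exists_minimiser_canonicalClass _ hn0.le hn2, fun _ hω hρ hmin =>
    re_expect_localPairAt_ge_of_minimiser hω hU hρ hn0 hn2 hh hlo hmin
      (exists_canonicalClass_sourced_le_of_clusterCap_of_clusterCapInterval ha₁ hb₁ ha₂ hb₂ U μ₁ μ₂ h hψ₁ h1₁ hψ₂
        h1₂ hN₁ hE₁ hNlo₂ hNhi₂ hE₂ hlt hle hulo huhi)⟩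

end TwoIntervals

end Summit.Ventures.CertifiedManyBodySolver.Observables

end
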